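import Summits.QuantumFields.YangMills.Theorems.SwapTwistDeficitPeriodicRingFloorToronBox
import Summits.QuantumFields.YangMills.Theorems.VirialFluxGapFixDimCount
import HarnessLib

/-!
# The product-Haar MASS of the toron box of the zero-flux ring in tree gauge: `ballVol(t₁)⁴·ballVol(t₂)^{6L⁴−3} ≤ μ_L{F₀ ≤ 400L⁴t₂²}`
# (free-hands support of item stmt-QuantumFields-23802 `SwapTwistDeficit.TwistRatioVanishesFixedL`; file 2 of 3 of brick (A0) of the fixed-`L`
# reduction memo of seat w2 g54 — the sharp floors themselves are in `SwapTwistDeficitPeriodicRingFloorSharp`)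

The toron valley of the periodic `2L × L³` ring has `18L⁴ − 3` massive directions (`24L⁴` link coordinates, a `6L⁴`-dimensional gauge group with
generic stabiliser `U(1)`, `4` holonomy moduli), so the small-ball volume of the action deficit `F₀ = RingDeficit.ringDeficit L 0` is
`≍ t^{9L⁴−3/2}` up to a logarithm.  This file supplies the measure-theoretic half of the lower bound with the SHARP exponent:

* `card_nonleaders` — `(2L³+1−3) + (2L−1)·3L³ + (L³−1) = 6L⁴ − 3`;
* ★ `ballVol_pow_le_ringMeasure_real_deficit_le` — for `0 ≤ t₁ ≤ 1`, `0 ≤ t₂`, `t₁² ≤ t₂`: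
  `ballVol(t₁)⁴ · ballVol(t₂)^{6L⁴−3} ≤ (ringMeasure L).real {F₀ ≤ 400·L⁴·t₂²}`.  In the slice-`0` tree gauge
  (✓`TreeGaugeTransfer.measureReal_deficit_le_eq_fix`: `μ_L{F₀ ≤ s}` is the product-Haar mass on `X_fix = SU(2)^{off} × (slices 1…2L−1) × (seam)` of
  `{F_fix ≤ s}`) the TORON BOX of ✓`PeriodicRingFloor.ringDeficit_le_of_toronBox` — 4 leaders (`w(−ê_μ,μ)`, `g 0`) in `B_{t₁}`, the other `6L⁴ − 3`
  variables within `t₂` of their letters — is the preimage of a straight product of balls under a product-Haar preserving map (letter translations are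
  skew products over the leaders, `MeasurePreserving.skew_product`, `measurePreserving_piEquivPiSubtypeProd`, left invariance of Haar; pattern of
  ✓`TwistExponentGapPeriodicToronFloorToronBox` §3), so its mass is EXACTLY `ballVol(t₁)⁴·ballVol(t₂)^{(2L³−2)+(2L−1)·3L³+(L³−1)}`.

HONEST FRAMING: fixed-lattice Haar-measure bookkeeping for the cheap direction (a floor) of a fixed-`L` Laplace asymptotic; ⟨23802⟩ as typed also
needs a CEILING for the swap-twisted trace at small `L`; no crux, rung or summit statement is proved; the Yang–Mills mass gap is NOT proved; no summit
is proved by a line.  THEOREMS ONLY (0 `def`, 0 `sorry`), standard axioms.  Width seat ym-line-sfw-p2-w3 g61 (cell ym-idea-1, free hands),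
`--supports stmt-QuantumFields-23802`.  References: [cite: Luscher1983, §2]; [cite: Vanbaal2001]; [cite: Chatterjee2016, Lemma 9.3].
-/

set_option autoImplicit false

noncomputable section

open MeasureTheory
open scoped BigOperators ENNReal
open Literature.MathematicalPhysics.QuantumFieldTheory hiding SU2
open Literature.MathematicalPhysics.QuantumLattice
open Summit.QuantumFields.YangMills.Theorems.FemtoTransferGap
open Summit.QuantumFields.YangMills.Theorems.FemtoTransferGap.TT
open Summit.QuantumFields.YangMills.Theorems.VirialFluxGap.RingDeficit
open Summit.QuantumFields.YangMills.Theorems.VirialFluxGap.TreeGaugeTransfer (measureReal_deficit_le_eq_fix)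
open Summit.QuantumFields.YangMills.Theorems.VirialFluxGap.FixSplit (card_offIdx)

namespace Summit.QuantumFields.YangMills.Theorems.SwapTwistDeficit.PeriodicRingFloor

variable {L : ℕ} [NeZero L]

/-! ## §1 The product-Haar mass of the toron box in tree gauge -/

omit [NeZero L] in
/-- The exponent count of the non-leader variables: `(2L³ + 1 − 3) + (2L − 1)·3L³ + (L³ − 1) = 6L⁴ − 3`. [folklore] -/
theorem card_nonleaders (hL : 1 ≤ L) : (2 * L ^ 3 + 1 - 3) + (2 * L - 1) * (3 * L ^ 3) + (L ^ 3 - 1) = 6 * L ^ 4 - 3 := by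
  have h3 : 1 ≤ L ^ 3 := Nat.one_le_pow _ _ hL
  have h4 : 1 ≤ L ^ 4 := Nat.one_le_pow _ _ hL
  zify [h3, (show 3 ≤ 2 * L ^ 3 + 1 by omega), (show 1 ≤ 2 * L by omega), (show 3 ≤ 6 * L ^ 4 by omega)]
  ring

/-- ★ **THE TORON BOX HAS PRODUCT-HAAR MASS `ballVol(t₁)⁴·ballVol(t₂)^{6L⁴−3}` AND DEFICIT `≤ 400L⁴t₂²`**: for `0 ≤ t₁ ≤ 1`, `0 ≤ t₂`, `t₁² ≤ t₂`,
`ballVol(t₁)⁴ · ballVol(t₂)^{6L⁴−3} ≤ (ringMeasure L).real {F₀ ≤ 400·L⁴·t₂²}`.  Tree gauge (✓`measureReal_deficit_le_eq_fix`), then the box of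
✓`ringDeficit_le_of_toronBox` as the preimage of a straight product of balls under a product-Haar preserving map: the slices `1…2L−1` are translated by
`glue w` (a skew product over the slice-`0` variables `w`), the slice-`0` off-tree links by their letters (a skew product over the three leader wrap links),
the seam field by `g 0` (a skew product over the site `0`). [cite: Chatterjee2016, Lemma 9.3] [cite: Luscher1983, §2] -/
theorem ballVol_pow_le_ringMeasure_real_deficit_le {t₁ t₂ : ℝ} (ht₁ : 0 ≤ t₁) (ht₁1 : t₁ ≤ 1) (ht₂ : 0 ≤ t₂) (h12 : t₁ ^ 2 ≤ t₂) :
    ballVol t₁ ^ 4 * ballVol t₂ ^ (6 * L ^ 4 - 3) ≤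
      (ringMeasure L).real {P | ringDeficit L (fun _ => false) P ≤ 400 * (L : ℝ) ^ 4 * t₂ ^ 2} := by
  haveI : (haarProbability SU2).IsMulLeftInvariant := by unfold haarProbability; infer_instance
  haveI : IsProbabilityMeasure (gaugeMeasure L) := isProbabilityMeasure_gaugeMeasure (L := L)
  -- the three factors of `X_fix` and their measures
  set μA : Measure (OffIdx L → SU2) := Measure.pi fun _ : OffIdx L => haarProbability SU2 with hμA
  set μB : Measure (Fin (2 * L - 1) → GaugeConfig 3 L SU2) := Measure.pi fun _ : Fin (2 * L - 1) => configMeasure SU2 L with hμB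
  set μC : Measure (Site 3 L → SU2) := gaugeMeasure L with hμC
  -- balls
  set B₁ : Set SU2 := {W : SU2 | frobNorm ((W : Matrix (Fin 2) (Fin 2) ℂ) - 1) ≤ t₁} with hB₁
  set B₂ : Set SU2 := {W : SU2 | frobNorm ((W : Matrix (Fin 2) (Fin 2) ℂ) - 1) ≤ t₂} with hB₂
  have hB₁m : MeasurableSet B₁ := measurableSet_frobBall_one t₁
  have hB₂m : MeasurableSet B₂ := measurableSet_frobBall_one t₂
  /- (A) slice 0: leaders and letters -/
  set Lead : Fin 3 → OffIdx L := fun μ => ⟨(Pi.single μ (-1 : ZMod L), μ), leader_not_treeEdge μ⟩ with hLead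
  have hLead_inj : Function.Injective Lead := fun μ ν h => by
    have := congrArg (fun i : OffIdx L => i.1.2) h
    simpa [hLead] using this
  set pA : OffIdx L → Prop := fun i => ∃ μ, i = Lead μ with hpA
  set πA₁ : Measure ({i // pA i} → SU2) := Measure.pi fun _ => haarProbability SU2 with hπA₁
  set πA₂ : Measure ({i // ¬pA i} → SU2) := Measure.pi fun _ => haarProbability SU2 with hπA₂
  set eA := MeasurableEquiv.piEquivPiSubtypeProd (fun _ : OffIdx L => SU2) pA with heA_def
  have heA : MeasurePreserving eA μA (πA₁.prod πA₂) := measurePreserving_piEquivPiSubtypeProd (fun _ : OffIdx L => haarProbability SU2) pA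
  set cA : ({i // pA i} → SU2) → OffIdx L → SU2 := fun a i =>
    (if i.1.1 i.1.2 = -1 then a ⟨Lead i.1.2, ⟨i.1.2, rfl⟩⟩ else 1)⁻¹ with hcA
  set ΦA : ({i // pA i} → SU2) → ({i // ¬pA i} → SU2) → ({i // ¬pA i} → SU2) := fun a b i => cA a i.1 * b i with hΦA
  have hΦAa : ∀ a, MeasurePreserving (ΦA a) πA₂ πA₂ := fun a =>
    measurePreserving_pi (fun _ : {i // ¬pA i} => haarProbability SU2) (fun _ : {i // ¬pA i} => haarProbability SU2)
      fun i => measurePreserving_mul_left (haarProbability SU2) (cA a i.1)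
  have hcAm : ∀ i : OffIdx L, Measurable fun a : {i // pA i} → SU2 => cA a i := by
    intro i
    by_cases hs : i.1.1 i.1.2 = -1
    · simp only [hcA, hs, if_true]; exact (measurable_pi_apply _).inv
    · simp only [hcA, hs, if_false, inv_one]; exact measurable_const
  have hΦAm : Measurable (Function.uncurry ΦA) := by
    refine measurable_pi_lambda _ fun i => ?_
    exact ((hcAm i.1).comp measurable_fst).mul ((measurable_pi_apply i).comp measurable_snd)
  set skA : ({i // pA i} → SU2) × ({i // ¬pA i} → SU2) → ({i // pA i} → SU2) × ({i // ¬pA i} → SU2) :=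
    fun z => (id z.1, ΦA z.1 z.2) with hskA
  have hskewA : MeasurePreserving skA (πA₁.prod πA₂) (πA₁.prod πA₂) :=
    (MeasurePreserving.id πA₁).skew_product hΦAm (ae_of_all _ fun a => (hΦAa a).map_eq)
  have hψA : MeasurePreserving (fun w => skA (eA w)) μA (πA₁.prod πA₂) := hskewA.comp heA
  /- (C) the seam field: leader `g 0` -/
  -- an OPAQUE copy of the predicate `x = 0` (so that every `Fintype {x // pC x}` below is the generic subtype instance)
  obtain ⟨pC, hpC⟩ : ∃ p : Site 3 L → Prop, ∀ x, p x ↔ x = 0 := ⟨fun x => x = 0, fun _ => Iff.rfl⟩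
  haveI hdecC : DecidablePred pC := fun x => decidable_of_iff _ (hpC x).symm
  have hp0 : pC 0 := (hpC 0).2 rfl
  set πC₁ : Measure ({x // pC x} → SU2) := Measure.pi fun _ => haarProbability SU2 with hπC₁
  set πC₂ : Measure ({x // ¬pC x} → SU2) := Measure.pi fun _ => haarProbability SU2 with hπC₂
  set eC := MeasurableEquiv.piEquivPiSubtypeProd (fun _ : Site 3 L => SU2) pC with heC_def
  have heC : MeasurePreserving eC μC (πC₁.prod πC₂) := by
    have hμC' : μC = Measure.pi fun _ : Site 3 L => haarProbability SU2 := rfl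
    rw [hμC']
    exact measurePreserving_piEquivPiSubtypeProd (fun _ : Site 3 L => haarProbability SU2) pC
  set ΦC : ({x // pC x} → SU2) → ({x // ¬pC x} → SU2) → ({x // ¬pC x} → SU2) := fun a b x => (a ⟨0, hp0⟩)⁻¹ * b x with hΦC
  have hΦCa : ∀ a, MeasurePreserving (ΦC a) πC₂ πC₂ := fun a =>
    measurePreserving_pi (fun _ : {x // ¬pC x} => haarProbability SU2) (fun _ : {x // ¬pC x} => haarProbability SU2)
      fun _ => measurePreserving_mul_left (haarProbability SU2) _
  have hΦCm : Measurable (Function.uncurry ΦC) := by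
    refine measurable_pi_lambda _ fun x => ?_
    exact ((measurable_pi_apply _).inv.comp measurable_fst).mul ((measurable_pi_apply x).comp measurable_snd)
  set skC : ({x // pC x} → SU2) × ({x // ¬pC x} → SU2) → ({x // pC x} → SU2) × ({x // ¬pC x} → SU2) :=
    fun z => (id z.1, ΦC z.1 z.2) with hskC
  have hskewC : MeasurePreserving skC (πC₁.prod πC₂) (πC₁.prod πC₂) :=
    (MeasurePreserving.id πC₁).skew_product hΦCm (ae_of_all _ fun a => (hΦCa a).map_eq)
  have hψC : MeasurePreserving (fun g => skC (eC g)) μC (πC₁.prod πC₂) := hskewC.comp heC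
  /- (B) the slices `1 … 2L−1`, translated by `glue w` — a skew product over `w` -/
  set τ : (OffIdx L → SU2) → (Fin (2 * L - 1) → GaugeConfig 3 L SU2) → (Fin (2 * L - 1) → GaugeConfig 3 L SU2) :=
    fun w r j e => (glue w e)⁻¹ * r j e with hτ
  have hτw : ∀ w, MeasurePreserving (τ w) μB μB := fun w => by
    have hin : MeasurePreserving (fun (U : GaugeConfig 3 L SU2) (e : Edge 3 L) => (glue w e)⁻¹ * U e)
        (configMeasure SU2 L) (configMeasure SU2 L) := by
      unfold configMeasure
      exact measurePreserving_pi (fun _ : Edge 3 L => haarProbability SU2) (fun _ : Edge 3 L => haarProbability SU2)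
        fun e => measurePreserving_mul_left (haarProbability SU2) ((glue w e)⁻¹)
    exact measurePreserving_pi (fun _ : Fin (2 * L - 1) => configMeasure SU2 L) (fun _ : Fin (2 * L - 1) => configMeasure SU2 L)
      fun _ => hin
  set Ψ₁ : (OffIdx L → SU2) × ((Fin (2 * L - 1) → GaugeConfig 3 L SU2) × (Site 3 L → SU2)) →
      (OffIdx L → SU2) × ((Fin (2 * L - 1) → GaugeConfig 3 L SU2) × (Site 3 L → SU2)) :=
    fun x => (id x.1, (τ x.1 x.2.1, x.2.2)) with hΨ₁
  have hfibm : Measurable (Function.uncurry fun (w : OffIdx L → SU2)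
      (q : (Fin (2 * L - 1) → GaugeConfig 3 L SU2) × (Site 3 L → SU2)) => (τ w q.1, q.2)) := by
    refine Measurable.prodMk ?_ (measurable_snd.comp measurable_snd)
    refine measurable_pi_lambda _ fun j => measurable_pi_lambda _ fun e => ?_
    exact (((measurable_pi_apply e).comp (measurable_glue.comp measurable_fst)).inv).mul
      ((measurable_pi_apply e).comp ((measurable_pi_apply j).comp (measurable_fst.comp measurable_snd)))
  have hfib : ∀ w, MeasurePreserving (fun q : (Fin (2 * L - 1) → GaugeConfig 3 L SU2) × (Site 3 L → SU2) => (τ w q.1, q.2))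
      (μB.prod μC) (μB.prod μC) := fun w => (hτw w).prod (MeasurePreserving.id μC)
  have hΨ₁m : MeasurePreserving Ψ₁ (μA.prod (μB.prod μC)) (μA.prod (μB.prod μC)) :=
    (MeasurePreserving.id μA).skew_product hfibm (ae_of_all _ fun w => (hfib w).map_eq)
  /- the straightening map and the straight box -/
  set Ψ₂ : (OffIdx L → SU2) × ((Fin (2 * L - 1) → GaugeConfig 3 L SU2) × (Site 3 L → SU2)) →
      (({i // pA i} → SU2) × ({i // ¬pA i} → SU2)) ×
        ((Fin (2 * L - 1) → GaugeConfig 3 L SU2) × (({x // pC x} → SU2) × ({x // ¬pC x} → SU2))) :=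
    Prod.map (fun w => skA (eA w)) (Prod.map id fun g => skC (eC g)) with hΨ₂
  have hΨ₂m : MeasurePreserving Ψ₂ (μA.prod (μB.prod μC)) ((πA₁.prod πA₂).prod (μB.prod (πC₁.prod πC₂))) :=
    hψA.prod ((MeasurePreserving.id μB).prod hψC)
  have hΨ : MeasurePreserving (fun x => Ψ₂ (Ψ₁ x)) (μA.prod (μB.prod μC)) ((πA₁.prod πA₂).prod (μB.prod (πC₁.prod πC₂))) :=
    hΨ₂m.comp hΨ₁m
  set SA : Set (({i // pA i} → SU2) × ({i // ¬pA i} → SU2)) :=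
    (Set.pi Set.univ fun _ => B₁) ×ˢ (Set.pi Set.univ fun _ => B₂) with hSA
  set SB : Set (Fin (2 * L - 1) → GaugeConfig 3 L SU2) :=
    Set.pi Set.univ fun _ => Set.pi Set.univ fun _ => B₂ with hSB
  set SC : Set (({x // pC x} → SU2) × ({x // ¬pC x} → SU2)) :=
    (Set.pi Set.univ fun _ => B₁) ×ˢ (Set.pi Set.univ fun _ => B₂) with hSC
  have hSAm : MeasurableSet SA := (MeasurableSet.univ_pi fun _ => hB₁m).prod (MeasurableSet.univ_pi fun _ => hB₂m)
  have hSBm : MeasurableSet SB := MeasurableSet.univ_pi fun _ => MeasurableSet.univ_pi fun _ => hB₂m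
  have hSCm : MeasurableSet SC := (MeasurableSet.univ_pi fun _ => hB₁m).prod (MeasurableSet.univ_pi fun _ => hB₂m)
  set P : Set ((OffIdx L → SU2) × ((Fin (2 * L - 1) → GaugeConfig 3 L SU2) × (Site 3 L → SU2))) :=
    (fun x => Ψ₂ (Ψ₁ x)) ⁻¹' (SA ×ˢ (SB ×ˢ SC)) with hP
  /- (1) the mass of the toron box -/
  have hcardA₁ : Fintype.card {i // pA i} = 3 := by
    have hmem : ∀ i : OffIdx L, i ∈ Finset.univ.image Lead ↔ pA i := fun i => by
      simp only [Finset.mem_image, Finset.mem_univ, true_and]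
      constructor
      · rintro ⟨μ, h⟩; exact ⟨μ, h.symm⟩
      · rintro ⟨μ, h⟩; exact ⟨μ, h.symm⟩
    rw [Fintype.card_of_subtype (Finset.univ.image Lead) hmem, Finset.card_image_of_injective _ hLead_inj, Finset.card_univ,
      Fintype.card_fin]
  have hcardA₂ : Fintype.card {i // ¬pA i} = 2 * L ^ 3 + 1 - 3 := by
    rw [Fintype.card_subtype_compl, hcardA₁, card_offIdx]
  have hcardC₁ : Fintype.card {x // pC x} = 1 := by
    rw [Fintype.card_of_subtype ({0} : Finset (Site 3 L)) (fun x => by rw [Finset.mem_singleton]; exact (hpC x).symm),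
      Finset.card_singleton]
  have hcardC₂ : Fintype.card {x // ¬pC x} = L ^ 3 - 1 := by
    rw [Fintype.card_subtype_compl, hcardC₁, TwoLattice.Electric.card_site]
  have hSBmass : μB (Set.pi Set.univ fun _ => Set.pi Set.univ fun _ => B₂) =
      (haarProbability SU2 B₂ ^ Fintype.card (Edge 3 L)) ^ (2 * L - 1) := by
    rw [hμB, Measure.pi_pi]
    simp only [configMeasure, Measure.pi_pi, Finset.prod_const, Finset.card_univ, Fintype.card_fin]
  have hPmass : (μA.prod (μB.prod μC)) P = haarProbability SU2 B₁ ^ 4 * haarProbability SU2 B₂ ^ (6 * L ^ 4 - 3) := by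
    have h1 : (μA.prod (μB.prod μC)) P = ((πA₁.prod πA₂).prod (μB.prod (πC₁.prod πC₂))) (SA ×ˢ (SB ×ˢ SC)) :=
      hΨ.measure_preimage (hSAm.prod (hSBm.prod hSCm)).nullMeasurableSet
    rw [h1]
    simp only [hSA, hSB, hSC, Measure.prod_prod]
    rw [hSBmass, hπA₁, hπA₂, hπC₁, hπC₂, Measure.pi_pi, Measure.pi_pi, Measure.pi_pi, Measure.pi_pi]
    simp only [Finset.prod_const, Finset.card_univ, hcardA₁, hcardA₂, hcardC₁, hcardC₂, FemtoTransferGap.card_edge_three]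
    rw [← card_nonleaders (L := L) NeZero.one_le]
    ring
  /- (2) on the toron box the deficit is small -/
  have hPsub : P ⊆ {x | ringDeficit L (fun _ => false)
      ((Fin.cons (glue x.1) x.2.1 : Fin (2 * L - 1 + 1) → GaugeConfig 3 L SU2), x.2.2) ≤ 400 * (L : ℝ) ^ 4 * t₂ ^ 2} := by
    rintro ⟨w, r, g⟩ hx
    have hx' : Ψ₂ (Ψ₁ (w, r, g)) ∈ SA ×ˢ (SB ×ˢ SC) := hx
    simp only [hΨ₂, hΨ₁, Prod.map_apply, id, Set.mem_prod] at hx'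
    obtain ⟨⟨hAL, hAR⟩, hBx, ⟨hCL, hCR⟩⟩ := hx'
    -- leaders of slice 0
    have hlead : ∀ μ : Fin 3, frobNorm ((w (Lead μ) : Matrix (Fin 2) (Fin 2) ℂ) - 1) ≤ t₁ := fun μ =>
      (Set.mem_univ_pi.1 hAL) ⟨Lead μ, ⟨μ, rfl⟩⟩
    -- letters of slice 0
    have hw : ∀ i : OffIdx L, frobNorm ((((if i.1.1 i.1.2 = -1 then w (Lead i.1.2) else 1)⁻¹ * w i : SU2) :
        Matrix (Fin 2) (Fin 2) ℂ) - 1) ≤ t₂ := by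
      intro i
      by_cases hpi : pA i
      · obtain ⟨μ, hμ⟩ := hpi
        have hs : i.1.1 i.1.2 = -1 := by rw [hμ]; simp [hLead]
        have hμ2 : i.1.2 = μ := by rw [hμ]
        rw [if_pos hs, hμ2, ← hμ, inv_mul_cancel]
        simp [frobNorm_zero, ht₂]
      · have h := (Set.mem_univ_pi.1 hAR) ⟨i, hpi⟩
        simp only [hskA, hΦA, hcA, heA_def, MeasurableEquiv.piEquivPiSubtypeProd_apply] at h
        exact h
    -- slices
    have hr : ∀ (j : Fin (2 * L - 1)) (e : Edge 3 L), frobNorm ((((glue w e)⁻¹ * r j e : SU2) : Matrix (Fin 2) (Fin 2) ℂ) - 1) ≤ t₂ :=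
      fun j e => (Set.mem_univ_pi.1 ((Set.mem_univ_pi.1 hBx) j)) e
    -- seam
    have hg0 : frobNorm ((g 0 : Matrix (Fin 2) (Fin 2) ℂ) - 1) ≤ t₁ := (Set.mem_univ_pi.1 hCL) ⟨0, hp0⟩
    have hg : ∀ x, frobNorm ((((g 0)⁻¹ * g x : SU2) : Matrix (Fin 2) (Fin 2) ℂ) - 1) ≤ t₂ := by
      intro x
      by_cases hx0 : x = 0
      · subst hx0; rw [inv_mul_cancel]; simp [frobNorm_zero, ht₂]
      · exact (Set.mem_univ_pi.1 hCR) ⟨x, fun h => hx0 ((hpC x).1 h)⟩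
    exact ringDeficit_le_of_toronBox ht₁ ht₁1 ht₂ h12 w r g hlead hw hr hg0 hg
  /- (3) assemble in real numbers -/
  haveI : IsProbabilityMeasure (μA.prod (μB.prod μC)) := by
    rw [hμA, hμB, hμC]; infer_instance
  rw [measureReal_deficit_le_eq_fix]
  calc ballVol t₁ ^ 4 * ballVol t₂ ^ (6 * L ^ 4 - 3)
      = ((μA.prod (μB.prod μC)) P).toReal := by
        rw [hPmass, ENNReal.toReal_mul, ENNReal.toReal_pow, ENNReal.toReal_pow]; rfl
    _ ≤ _ := by
        rw [← measureReal_def]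
        exact measureReal_mono hPsub (measure_ne_top _ _)

end Summit.QuantumFields.YangMills.Theorems.SwapTwistDeficit.PeriodicRingFloor

end
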